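import Summits.CriticalPhenomena.PercolationContinuityZ3.Theorems.Transplant.FKConnectivityAllQForestAdjacentRayleigh
import Summits.CriticalPhenomena.PercolationContinuityZ3.Theorems.Transplant.FKConnectivityAllQArborealContraction
import HarnessLib

/-!
# Adjacent-pair coefficientwise forest Rayleigh — the NON-DEGENERATE node `AdjForestRayleighPos` (NOT asserted) and a kernel
# REFUTATION of the degenerate case: `ForestAdjRayleighOn V` of the companion file omits the hypothesis `v ≠ y` and is FALSE when
# `e = f` (`¬ ForestAdjRayleighPos`); with `v ≠ y` the statement is the lineage's (♣) and keeps its arboreal-gas consequence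

Support file (`--supports stmt-CriticalPhenomena-4575`), FK sub-lane `prim-bschramm-fk-1` (gen 16) of the post-continuity programme;
builds on p205010 (kernel theorem, internal audit signed; external expert review pending).  Definitions (one counting predicate, one
`@[conjecture]` node — NOT asserted), no named facts, no sorries; standard axioms.

ERRATUM (same seat, same generation).  `…ForestAdjacentRayleigh.lean` typed the fibre form of (♣) for ALL triples `(o, v, y)`.  When
`v = y` the two pinned pairs coincide (`e = f = ov`) and the bookkeeping `F_e F_f − F_{ef} F = x_e x_f(…)` behind the fibre form breaks:
on the vertex type `Fin 2` with `o = 0`, `v = y = 1`, fibre `M = {e}`, `u₀ = ∅`, the configuration `ω = {e}` is a forest with `e, f ∈ ω` and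
`ω ∆ M = ∅` a forest, so `bad ≥ 1`, while `good = 0` (no configuration has `e ∈ ω` and `e ∈ ω ∆ {e}`).  Hence
**`not_forestAdjRayleighOn_fin_two : ¬ ForestAdjRayleighOn (Fin 2)`** and **`not_forestAdjRayleighPos : ¬ ForestAdjRayleighPos`** (kernel) —
a refutation of the DEGENERATE CASE of the node as typed, not of (♣): in pattern form (`N(0,OVY) ≤ …`) the left side is `0` when `v = y`,
and every census of (♣) (memo bschramm/FROM-fk-1-g16-FOREST-SLICE.md §1: all graphs with ≤ 7 vertices, 2.3·10⁸ placements, 0 failures)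
used three DISTINCT marked vertices.
THE NON-DEGENERATE NODE `AdjForestRayleighOn V`: the same fibre inequality for all `(M, u₀)` and all `o, v, y` with `v ≠ y`
(`o = v` or `o = y` make a pinned pair diagonal and both sides `0`, so they need no exclusion).  CONJECTURE-SHAPED, NOT asserted;
`@[conjecture] AdjForestRayleighPos`.  Evidence: as above, plus 2,300 random general fibres on ≤ 6 vertices (numerics/fibrecheck.py).
It is the lowest `q`-slice of `TwoClusterRayleighGradedPos` (there the sure-join hypotheses exclude the degenerate case automatically) and
it is FALSE for non-adjacent pairs (K₄; Semple–Welsh Thm. 4.2).  KERNEL (verbatim from the companion file, with `v ≠ y` threaded through):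
**`real_forest_sq_ineq_of_adjForest`** (`P(Fo∩J_e∩J_f)P(Fo) + P(𝒳_e)P(𝒳_f) ≤ P(Fo∩J_e)P(Fo∩J_f)`, `P = prodBernoulli w`) and
**`ag_adjacent_negCorr_of_adjForest`** (`μ(J_e∩J_f)μ(Ω) + μ(𝒳_e)μ(𝒳_f) ≤ μ(J_e)μ(J_f)` for the arboreal gas `μ = agMeasure w`, every `w`,
`e = ov ≠ f = oy`).
[cite: CibulkaHladkyLaCroixWagner2008, Thm. 1 (p. 2)] [cite: SempleWelsh2008, Conj. 1.1 (p. 2); Thm. 4.2 (p. 11)]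
[cite: Grimmett2006, §1.5 eq. (1.22), Thm. (1.23) (pp. 13–14); §3.9 (pp. 63–65)] [cite: Linusson2011, Prop. 2.6]
-/

noncomputable section

namespace Summit.CriticalPhenomena.PercolationContinuityZ3.Theorems

namespace FK

open MeasureTheory Set Literature.Probability.LatticeModels Literature.Probability.Percolation
open scoped Classical symmDiff

variable {V : Type*} [Fintype V]

/-! ### The non-degenerate node -/

/-- **Adjacent-pair coefficientwise forest Rayleigh on the vertex type `V`, non-degenerate form** (`v ≠ y`, i.e. `e = ov ≠ f = oy`):
for every fibre `(M, u₀)`, `#(Fo ∩ J_e ∩ J_f, Fo) + #({e ∈ ω, ω ∖ {e} ∈ 𝒳}, {f ∈ ω, ω ∖ {f} ∈ 𝒳}) ≤ #(Fo ∩ J_e, Fo ∩ J_f)`.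
[cite: CibulkaHladkyLaCroixWagner2008, Thm. 1 (p. 2)] [cite: SempleWelsh2008, Conj. 1.1 (p. 2)] [cite: Linusson2011, Prop. 2.6] -/
def AdjForestRayleighOn (V : Type*) [Fintype V] : Prop :=
  ∀ (M u₀ : BondConfig V), Disjoint u₀ M → ∀ (o v y : V), v ≠ y →
    fibreCount M u₀ (forestEv V ∩ {ω | s(o, v) ∈ ω ∧ s(o, y) ∈ ω}) (forestEv V) +
      fibreCount M u₀ {ω | s(o, v) ∈ ω ∧ ω \ {s(o, v)} ∈ xMinusEv o v y} {ω | s(o, y) ∈ ω ∧ ω \ {s(o, y)} ∈ xMinusEv o v y} ≤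
      fibreCount M u₀ (forestEv V ∩ {ω | s(o, v) ∈ ω}) (forestEv V ∩ {ω | s(o, y) ∈ ω})

/-- **Adjacent-pair coefficientwise forest Rayleigh, non-degenerate form, on every finite vertex type** — the lineage's (♣).
CONJECTURE-SHAPED COUNTING STATEMENT, NOT asserted; 0 failures on all graphs with ≤ 7 vertices (1.7·10⁸ placements), all multigraphs with
≤ 6 vertices (multiplicity ≤ 2, ≤ 9 edges; 5.0·10⁷) and 2,300 random general fibres; false for non-adjacent pairs (K₄).
[cite: CibulkaHladkyLaCroixWagner2008, Thm. 1 (p. 2)] [cite: SempleWelsh2008, Conj. 1.1 (p. 2); Thm. 4.2 (p. 11)] -/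
@[conjecture] def AdjForestRayleighPos : Prop := ∀ n : ℕ, AdjForestRayleighOn (Fin n)

/-- The over-general node implies the non-degenerate one (so everything proved from the latter applies a fortiori).
[cite: CibulkaHladkyLaCroixWagner2008, Thm. 1 (p. 2)] -/
theorem adjForestRayleighOn_of_forestAdj (h : ForestAdjRayleighOn V) : AdjForestRayleighOn V :=
  fun M u₀ hd o v y _ => h M u₀ hd o v y

/-! ### Kernel consequences of the non-degenerate node -/

/-- **Node ⇒ `P(Fo ∩ J_e ∩ J_f)·P(Fo) + P(𝒳_e)·P(𝒳_f) ≤ P(Fo ∩ J_e)·P(Fo ∩ J_f)`** (`P = prodBernoulli w`, `e = ov`, `f = oy`, `v ≠ y`).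
[cite: Linusson2011, Prop. 2.6] [cite: CibulkaHladkyLaCroixWagner2008, Thm. 1 (p. 2)] -/
theorem real_forest_sq_ineq_of_adjForest (h : AdjForestRayleighOn V) (w : Sym2 V → unitInterval) {o v y : V} (hvy : v ≠ y) :
    (prodBernoulli w).real (forestEv V ∩ {ω | s(o, v) ∈ ω ∧ s(o, y) ∈ ω}) * (prodBernoulli w).real (forestEv V) +
      (prodBernoulli w).real {ω | s(o, v) ∈ ω ∧ ω \ {s(o, v)} ∈ xMinusEv o v y} *
        (prodBernoulli w).real {ω | s(o, y) ∈ ω ∧ ω \ {s(o, y)} ∈ xMinusEv o v y} ≤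
      (prodBernoulli w).real (forestEv V ∩ {ω | s(o, v) ∈ ω}) * (prodBernoulli w).real (forestEv V ∩ {ω | s(o, y) ∈ ω}) :=
  real_mul_add_mul_le_of_fibrewise_pos w _ _ _ _ _ _ fun M u₀ hd _ => h M u₀ hd o v y hvy

/-- **Node ⇒ adjacent edges are negatively correlated under the arboreal gas, with the square term** (`e = ov ≠ f = oy`):
`μ(J_e ∩ J_f)·μ(Ω) + μ(𝒳_e)·μ(𝒳_f) ≤ μ(J_e)·μ(J_f)`, `μ = agMeasure w`, every `w`.
[cite: Grimmett2006, §1.5 eq. (1.22), Thm. (1.23) (pp. 13–14); §3.9 (pp. 63–65)] [cite: SempleWelsh2008, Conj. 1.1 (p. 2)] -/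
theorem ag_adjacent_negCorr_of_adjForest (h : AdjForestRayleighOn V) (w : Sym2 V → unitInterval) {o v y : V} (hvy : v ≠ y) :
    (agMeasure w).real {ω | s(o, v) ∈ ω ∧ s(o, y) ∈ ω} * (agMeasure w).real univ +
      (agMeasure w).real {ω | s(o, v) ∈ ω ∧ ω \ {s(o, v)} ∈ xMinusEv o v y} *
        (agMeasure w).real {ω | s(o, y) ∈ ω ∧ ω \ {s(o, y)} ∈ xMinusEv o v y} ≤
      (agMeasure w).real {ω | s(o, v) ∈ ω} * (agMeasure w).real {ω | s(o, y) ∈ ω} := by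
  by_cases hZ : agPartition w = 0
  · have h0 : ∀ A : Set (BondConfig V), (agMeasure w).real A = 0 := by
      intro A
      rw [agMeasure_real_eq_sum]
      refine Finset.sum_eq_zero fun ω _ => ?_
      unfold agMass; rw [hZ, div_zero, zero_mul]
    simp only [h0, mul_zero, zero_add, le_refl]
  · have hZpos : 0 < agPartition w := lt_of_le_of_ne (agPartition_nonneg w) (Ne.symm hZ)
    rw [← mul_le_mul_iff_of_pos_right (mul_pos hZpos hZpos)]
    have key := real_forest_sq_ineq_of_adjForest h w hvy (o := o)
    have e1 := agMeasure_real_mul_agPartition w {ω | s(o, v) ∈ ω ∧ s(o, y) ∈ ω}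
    have e2 := agMeasure_real_mul_agPartition w (univ : Set (BondConfig V))
    have e3 := agMeasure_real_mul_agPartition w {ω | s(o, v) ∈ ω ∧ ω \ {s(o, v)} ∈ xMinusEv o v y}
    have e4 := agMeasure_real_mul_agPartition w {ω | s(o, y) ∈ ω ∧ ω \ {s(o, y)} ∈ xMinusEv o v y}
    have e5 := agMeasure_real_mul_agPartition w {ω | s(o, v) ∈ ω}
    have e6 := agMeasure_real_mul_agPartition w {ω | s(o, y) ∈ ω}
    rw [univ_inter] at e2
    calc ((agMeasure w).real {ω | s(o, v) ∈ ω ∧ s(o, y) ∈ ω} * (agMeasure w).real univ +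
          (agMeasure w).real {ω | s(o, v) ∈ ω ∧ ω \ {s(o, v)} ∈ xMinusEv o v y} *
            (agMeasure w).real {ω | s(o, y) ∈ ω ∧ ω \ {s(o, y)} ∈ xMinusEv o v y}) * (agPartition w * agPartition w)
        = ((agMeasure w).real {ω | s(o, v) ∈ ω ∧ s(o, y) ∈ ω} * agPartition w) * ((agMeasure w).real univ * agPartition w) +
          ((agMeasure w).real {ω | s(o, v) ∈ ω ∧ ω \ {s(o, v)} ∈ xMinusEv o v y} * agPartition w) *
            ((agMeasure w).real {ω | s(o, y) ∈ ω ∧ ω \ {s(o, y)} ∈ xMinusEv o v y} * agPartition w) := by ring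
      _ = (prodBernoulli w).real (forestEv V ∩ {ω | s(o, v) ∈ ω ∧ s(o, y) ∈ ω}) * (prodBernoulli w).real (forestEv V) +
          (prodBernoulli w).real ({ω | s(o, v) ∈ ω ∧ ω \ {s(o, v)} ∈ xMinusEv o v y} ∩ forestEv V) *
            (prodBernoulli w).real ({ω | s(o, y) ∈ ω ∧ ω \ {s(o, y)} ∈ xMinusEv o v y} ∩ forestEv V) := by
          rw [e1, e2, e3, e4, inter_comm]
      _ ≤ (prodBernoulli w).real (forestEv V ∩ {ω | s(o, v) ∈ ω ∧ s(o, y) ∈ ω}) * (prodBernoulli w).real (forestEv V) +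
          (prodBernoulli w).real {ω | s(o, v) ∈ ω ∧ ω \ {s(o, v)} ∈ xMinusEv o v y} *
            (prodBernoulli w).real {ω | s(o, y) ∈ ω ∧ ω \ {s(o, y)} ∈ xMinusEv o v y} :=
          add_le_add le_rfl (mul_le_mul (measureReal_mono inter_subset_left (measure_ne_top (prodBernoulli w) _))
            (measureReal_mono inter_subset_left (measure_ne_top (prodBernoulli w) _)) measureReal_nonneg measureReal_nonneg)
      _ ≤ (prodBernoulli w).real (forestEv V ∩ {ω | s(o, v) ∈ ω}) * (prodBernoulli w).real (forestEv V ∩ {ω | s(o, y) ∈ ω}) := key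
      _ = ((agMeasure w).real {ω | s(o, v) ∈ ω} * agPartition w) * ((agMeasure w).real {ω | s(o, y) ∈ ω} * agPartition w) := by
          rw [e5, e6, inter_comm, inter_comm {ω | s(o, y) ∈ ω}]
      _ = (agMeasure w).real {ω | s(o, v) ∈ ω} * (agMeasure w).real {ω | s(o, y) ∈ ω} * (agPartition w * agPartition w) := by ring

/-! ### Two generic fibre-count facts -/

/-- A fibre count vanishes if no configuration on the fibre meets both events. [cite: Linusson2011, Prop. 2.6] -/
theorem fibreCount_eq_zero_of_forall (M u : BondConfig V) (A B : Set (BondConfig V))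
    (h : ∀ ω : BondConfig V, ω \ M = u → ω ∈ A → ω ∆ M ∈ B → False) : fibreCount M u A B = 0 := by
  unfold fibreCount
  rw [Finset.card_eq_zero]
  exact Finset.filter_eq_empty_iff.2 fun ω _ hω => h ω hω.1 hω.2.1 hω.2.2

/-- A fibre count is at least one if some configuration on the fibre meets both events. [cite: Linusson2011, Prop. 2.6] -/
theorem one_le_fibreCount_of_mem (M u : BondConfig V) (A B : Set (BondConfig V)) (ω : BondConfig V) (h1 : ω \ M = u) (h2 : ω ∈ A)
    (h3 : ω ∆ M ∈ B) : 1 ≤ fibreCount M u A B := by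
  unfold fibreCount
  exact Finset.one_le_card.2 ⟨ω, Finset.mem_filter.2 ⟨Finset.mem_univ _, h1, h2, h3⟩⟩

/-! ### The degenerate case `v = y` refutes the over-general node -/

/-- **`¬ ForestAdjRayleighOn (Fin 2)`**: with `o = 0`, `v = y = 1` (`e = f`), fibre `M = {e}`, `u₀ = ∅`, the forest `ω = {e}` makes the
"bad" count `≥ 1` while the "good" count vanishes (no configuration contains `e` together with its flip).  A refutation of the DEGENERATE
CASE of the node as typed; the intended statement is `AdjForestRayleighOn`. [cite: CibulkaHladkyLaCroixWagner2008, Thm. 1 (p. 2)] -/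
theorem not_forestAdjRayleighOn_fin_two : ¬ ForestAdjRayleighOn (Fin 2) := by
  intro h
  have h01 : (0 : Fin 2) ≠ 1 := by decide
  have key := h ({s((0 : Fin 2), (1 : Fin 2))} : BondConfig (Fin 2)) ∅ disjoint_bot_left 0 1 1
  -- the "good" count is zero: `e ∈ ω` and `e ∈ ω ∆ {e}` are incompatible
  have hgood : fibreCount ({s((0 : Fin 2), (1 : Fin 2))} : BondConfig (Fin 2)) ∅
      (forestEv (Fin 2) ∩ {ω | s((0 : Fin 2), (1 : Fin 2)) ∈ ω}) (forestEv (Fin 2) ∩ {ω | s((0 : Fin 2), (1 : Fin 2)) ∈ ω}) = 0 := by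
    refine fibreCount_eq_zero_of_forall _ _ _ _ fun ω _ hA hB => ?_
    have h1 : s((0 : Fin 2), (1 : Fin 2)) ∈ ω := hA.2
    have h2 : ω ∆ {s((0 : Fin 2), (1 : Fin 2))} ∈ {ω : BondConfig (Fin 2) | s((0 : Fin 2), (1 : Fin 2)) ∈ ω} := hB.2
    rw [mem_setOf_eq, Set.mem_symmDiff] at h2
    rcases h2 with ⟨_, h2⟩ | ⟨_, h2⟩
    · exact h2 (mem_singleton _)
    · exact h2 h1
  -- the "bad" count is at least one: the forest `{e}`
  have hforest1 : IsForestCfg ({s((0 : Fin 2), (1 : Fin 2))} : BondConfig (Fin 2)) := by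
    rw [show ({s((0 : Fin 2), (1 : Fin 2))} : BondConfig (Fin 2)) = insert s((0 : Fin 2), (1 : Fin 2)) ∅ by ext x; simp]
    refine (isForestCfg_insert_iff h01 (Set.notMem_empty _)).2 ⟨isForestCfg_empty, ?_⟩
    intro hr
    have hbot : openGraph (∅ : BondConfig (Fin 2)) = ⊥ := by ext a b; simp [openGraph]
    rw [hbot] at hr
    exact h01 (SimpleGraph.reachable_bot.1 hr)
  have hbad : 1 ≤ fibreCount ({s((0 : Fin 2), (1 : Fin 2))} : BondConfig (Fin 2)) ∅
      (forestEv (Fin 2) ∩ {ω | s((0 : Fin 2), (1 : Fin 2)) ∈ ω ∧ s((0 : Fin 2), (1 : Fin 2)) ∈ ω}) (forestEv (Fin 2)) := by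
    refine one_le_fibreCount_of_mem _ _ _ _ {s((0 : Fin 2), (1 : Fin 2))} Set.sdiff_self ⟨hforest1, mem_singleton _, mem_singleton _⟩ ?_
    show IsForestCfg (({s((0 : Fin 2), (1 : Fin 2))} : BondConfig (Fin 2)) ∆ {s((0 : Fin 2), (1 : Fin 2))})
    rw [symmDiff_self, Set.bot_eq_empty]
    exact isForestCfg_empty
  rw [hgood] at key
  omega

/-- **`¬ ForestAdjRayleighPos`** — the over-general node of `…ForestAdjacentRayleigh.lean` fails in the degenerate case `v = y` (at `n = 2`);
the non-degenerate node `AdjForestRayleighPos` is the intended (♣). [cite: CibulkaHladkyLaCroixWagner2008, Thm. 1 (p. 2)] -/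
theorem not_forestAdjRayleighPos : ¬ ForestAdjRayleighPos := fun h => not_forestAdjRayleighOn_fin_two (h 2)

end FK

end Summit.CriticalPhenomena.PercolationContinuityZ3.Theorems

end
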